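/-
Copyright (c) 2026 the pub-hodgecm-mathlib formalisation cell (harness21).  Prover seat hodgecm-mathlib-LH4-p13 (g10), req620 Track A «(D-RAM) FOUR-FRAME» squad
F0∕P3c∕LH4; the (β₂) road (R-36), β₂ WORDs #34∕#36 «THE MIX-HI WALL» (lead LH4-p13, second LH7-p09 (g3)): the product socket RESTRICTED TO A FLIP-INVARIANT SIDE DIGIT
(the exact-level digit of the U∕D MIX bands); helper lane on h413 = stmt-HodgeConjecture-24833 (count-neutral).  2026-09-05.
-/
import Summits.HodgeConjecture.HodgeConjecture.Theorems.F0P3cDyRamConeCellProductSocket   -- ★ p864302 (LH7-p09 (g3)): §1 `ncard_sep_and_eq_of_supportReversing_of_invariant`, §3 `rayTrace_mul_left`; brings ★ `…FaceTubeAbove`, ★ `…ConeWeightHalfSplit`, ★ `…ConeCellFlipBalance`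
import HarnessLib

/-!
# Crux `H413`, line LH4 «(D-RAM) FOUR-FRAME» — STAGE-1b, row (2) of `f_{T₊}`, the (β₂) road (R-36), the MIX-HI WALL (β₂ WORDs #34∕#36): «THE PRODUCT SOCKET ON A SIDE DIGIT» —
# on a cone cell `levelSetDep(j, b; μ)` with `d ≤ b`, for any FLIP-INVARIANT side digit `NX` (the exact-level digit `|e₀(Λ)| = |ϖ|^{ℓ₀}` of the U∕D MIX bands), the weighted
# two-literal difference VANISHES as soon as the product character `Π` is balanced over the `NX`-part of the cell

Cell `hodgecm-mathlib` (D-0151), FLOOR 0, crux item H413 = `stmt-HodgeConjecture-24833`, route of record `HCCMUnconditional`; squads F0∕P3c∕LH4 ∕ LH7; lane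
`--supports stmt-HodgeConjecture-24833 --as helper` (count-neutral; pays NO tier-0 row).  THEOREMS ONLY (no `def`, no instance, no notation, no `sorry`, default heartbeats);
★-only imports; states NO law; (β₂) and the MIX-HI band letters stay HYPOTHESES.  Frame of §2 = ★ p864302 `cellDiff_eq_zero_of_flip_of_prodBalance`'s VERBATIM + one more cell
predicate `NX` with its flip letter.

WHY (MIX-HI lead; LH7-p09 (g3) 02:14:45Z «the socket is cell-agnostic; for U∕D you need only the reads»).  On the LOWER line every member of a cell sits at level exactly `ℓ₀`
(★ p863399), so ★ p864302's reads `f ≠ 0 → (P₁ ↔ Π)`, `f ≠ 0 → (Q₁ ↔ ¬Π)` are consistent.  On the UPPER line and the DIAGONAL (`hU_mix`, `hD_mix`: `m < 2b`) the level of a glued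
vertex VARIES over the cell (★ p864080: exact level `ℓ₀` ⟺ `|e₀| = |ϖ|^{ℓ₀}` on the ray scalar), and BOTH literals of the two-class form (★ p864456∕p864457) carry «exact level `ℓ₀`»:
a populated member OFF that digit satisfies neither literal, so the reads must be `f ≠ 0 → (P₁ ↔ NX ∧ Π)`, `f ≠ 0 → (Q₁ ↔ NX ∧ ¬Π)` and the balance must be taken over
`{Λ ∈ cell ∣ NX Λ}`.  THIS FILE:
* §1 `exactDigit_smul_iff` — the FLIP LETTER of the exact-level digit `NX Λ :↔ ∃ presentation x₀ of Λ with ray scalar e₀, |e₀| = |ϖ|^{ℓ₀}`: `NX (z • Λ) ↔ NX Λ` for every exact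
  flip `z·Θz = jE ξ₀`, `ξ₀` a `σ`-fixed unit (`e₀ ↦ e₀∕ξ₀`; ★ `dualGen_mul_left`, ★ `isOrd_mul_left_iff_of_fixed_unit`) — datum-light, as ★ p864303 §1.
* §2 HEAD `cellDiff_eq_zero_of_flip_of_prodBalance_on` — ★ p864302's socket with the side digit: `NX`, `Π` flip-invariant on the cell, `#{cell ∣ NX ∧ Π} = #{cell ∣ NX ∧ ¬Π}`, the
  two reads above ⟹ `Σᶠ_{cell ∩ P₁} f − Σᶠ_{cell ∩ Q₁} f = 0` (★ HEAD-hi `finsum_levelSetDep_inter_weight_eq_iff_of_le`, ★ `smul_mem_levelSetDep_iff_of_flip`,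
  ★ `weight_smul_ne_zero_iff_weight_eq_zero_of_le`, ★ p864302 §1 on `S := {Λ ∈ cell ∣ NX Λ}`).  `NX := True` recovers ★ p864302.
HONEST LABEL.  Count-neutral composition of ★ pieces; nothing printed is asserted; no census law is stated; ‹PRODBAL-U›∕‹PRODBAL-D› (the balances), ‹U-MIX-2C›∕‹D-MIX-2C›, the
MIX-HI band letters and (β₂) `stub_law_cleanSgn₂` stay OPEN; `HC_CM` is proved only modulo the 7 printed citations (2 remaining named inputs: hLiu418 = `stmt-HodgeConjecture-24832`,
h413 = `stmt-HodgeConjecture-24833`) until rung 0 closes.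
## References
* [Kottwitz1986BaseChangeUnits] R. E. Kottwitz, *Base change for unit elements of Hecke algebras*, Compositio Math. 60 (1986): §1 pp. 240–241 (signed lattice counts, cell by cell).
* [Rogawski1990] J. D. Rogawski, *Automorphic Representations of Unitary Groups in Three Variables*, Ann. of Math. Stud. 123 (1990): §4.9 Prop. 4.9.1 (b) p. 55.
* [LabesseLanglands1979] J.-P. Labesse, R. P. Langlands, *L-indistinguishability for SL(2)*, Canad. J. Math. 31 (1979): §2 p. 8 (the norm-residue dichotomy).
* [Serre1979] J.-P. Serre, *Local Fields*, GTM 67 (1979): Ch. V §3 Prop. 5, Cor. 2–3 pp. 84–86 (norm classes of units); Ch. III §6 Prop. 12.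
* [Jacobowitz1962] R. Jacobowitz, *Hermitian forms over local fields*, Amer. J. Math. 84 (1962): §4 (duals, gluing).
-/

set_option autoImplicit false

noncomputable section

open scoped Pointwise Valued WithZero Matrix MatrixGroups
open WithZero
open scoped Classical
open Literature.NumberTheory.Automorphic Literature.NumberTheory.Automorphic.HermitianLattice Literature.NumberTheory.Automorphic.UnitaryLatticeTree
open Literature.NumberTheory.Automorphic.UnitaryThreeFourFrame (IsRamifiedQuadraticDatum)
open Literature.NumberTheory.Automorphic.EllipticPlaneAsFieldLine
open Literature.NumberTheory.LocalFields.QuadraticOrder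
open Literature.NumberTheory.LocalFields.WildQuadraticDatum
open Summit.HodgeConjecture.HodgeConjecture.Cruxes.H413.F0P3cDyRamToricCensusDefs
open Summit.HodgeConjecture.HodgeConjecture.Cruxes.H413.F0P3cDyRamConeWeightHalfSplit
open Summit.HodgeConjecture.HodgeConjecture.Cruxes.H413.F0P3cDyRamConeCellFlipBalance
open Summit.HodgeConjecture.HodgeConjecture.Cruxes.H413.F0P3cDyRamConeCellFaceTubeAbove (finsum_levelSetDep_inter_weight_eq_iff_of_le weight_smul_ne_zero_iff_weight_eq_zero_of_le)
open Summit.HodgeConjecture.HodgeConjecture.Cruxes.H413.F0P3cDyRamConeCellProductSocket (ncard_sep_and_eq_of_supportReversing_of_invariant)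

namespace Summit.HodgeConjecture.HodgeConjecture.Cruxes.H413.F0P3cDyRamMixBandProductSocket

/-! ## §1 The flip letter of the exact-level digit -/

section Digit

variable {E M : Type} [Field E] [Valued E ℤᵐ⁰] [Field M] [Valued M ℤᵐ⁰] {ρ Θ : M →+* M} {α : M}

/-- **FLIP LETTER — THE EXACT-LEVEL DIGIT IS INVARIANT UNDER EVERY EXACT FLIP.**  `NX` = the digit predicate «some presentation `x₀` of `Λ` (order ∕ primitivity ∕ level-`b`
clauses in the cell currency `jE ϖ^j`) has ray scalar `e₀` (`jE e₀ = Tr_ρ(μ ∕ (jE ϖ^j·(α − ρα)·ΘY(x₀)))`) with `|e₀| = |ϖ|^{ℓ₀}`» (its defining `Iff` is `hNX`; no `def`).  For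
`z·Θz = jE ξ₀` with `σξ₀ = ξ₀`, `|ξ₀| = 1` (`Θ∘jE = jE∘σ`, `Fix ρ = jE(E)`, `jE` isometric): `NX (z • Λ) ↔ NX Λ` for every additive subgroup `Λ` — the witness
`(x₀, e₀)` goes to `(z·x₀, e₀∕ξ₀)` (★ `dualGen_mul_left`, ★ `isOrd_mul_left_iff_of_fixed_unit`), and `|e₀∕ξ₀| = |e₀|`.  (By ★ p864080 `exactLevel_iff_v_rayScalar_eq` this digit is
«the glued vertex sits at level exactly `ℓ₀`».) [cite: Jacobowitz1962, §4] [cite: Serre1979, Ch. III §6 Prop. 12] -/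
theorem exactDigit_smul_iff {σ : E →+* E} {ϖ : E} (jE : E →+* M)
    (hjiso : ∀ c, Valued.v (jE c) = Valued.v c) (hjfix : ∀ z, ρ z = z ↔ ∃ c, jE c = z) (hΘj : ∀ c, Θ (jE c) = jE (σ c))
    (h : M) (j b ℓ₀ : ℕ) (μ : M)
    (NX : AddSubgroup M → Prop)
    (hNX : ∀ Λ, NX Λ ↔ ∃ (x₀ : M) (e₀ : E), x₀ ≠ 0 ∧ (∀ x, x ∈ Λ ↔ ∃ ζ, IsOrd ρ α (jE ϖ ^ j) ζ ∧ x = x₀ * ζ) ∧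
      IsOrd ρ α (jE ϖ ^ j) (dualGen ρ Θ α (jE ϖ ^ j) h x₀) ∧ ¬ IsOrd ρ α (jE ϖ ^ j) (dualGen ρ Θ α (jE ϖ ^ j) h x₀ / jE ϖ) ∧
      Valued.v (dualGen ρ Θ α (jE ϖ ^ j) h x₀) = Valued.v (jE ϖ) ^ b ∧
      jE e₀ = μ / (jE ϖ ^ j * (α - ρ α) * Θ (dualGen ρ Θ α (jE ϖ ^ j) h x₀)) + ρ (μ / (jE ϖ ^ j * (α - ρ α) * Θ (dualGen ρ Θ α (jE ϖ ^ j) h x₀))) ∧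
      Valued.v e₀ = Valued.v ϖ ^ ℓ₀)
    {z : M} {ξ₀ : E} (hz : z * Θ z = jE ξ₀) (hσξ : σ ξ₀ = ξ₀) (hξ1 : Valued.v ξ₀ = 1) (Λ : AddSubgroup M) :
    NX (z • Λ) ↔ NX Λ := by
  -- one direction for any flip data `(z', ξ')`
  have key : ∀ (z' : M) (ξ' : E), z' * Θ z' = jE ξ' → σ ξ' = ξ' → Valued.v ξ' = 1 → ∀ Λ' : AddSubgroup M, NX Λ' → NX (z' • Λ') := by
    intro z' ξ' hz' hσξ' hξ'1 Λ' hP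
    have hρj : ρ (jE ξ') = jE ξ' := (hjfix _).2 ⟨ξ', rfl⟩
    have hj1 : Valued.v (jE ξ') = 1 := by rw [hjiso, hξ'1]
    have hj0 : jE ξ' ≠ 0 := fun h0 => by rw [h0, map_zero] at hj1; exact zero_ne_one hj1
    have hz'0 : z' ≠ 0 := fun h0 => hj0 (by rw [← hz', h0, zero_mul])
    have hΘjξ : Θ (jE ξ') = jE ξ' := by rw [hΘj, hσξ']
    obtain ⟨x₀, e₀, hx₀, hΛx, hyO, hyp, hylev, he₀, he₀v⟩ := (hNX Λ').1 hP
    have hY : dualGen ρ Θ α (jE ϖ ^ j) h (z' * x₀) = jE ξ' * dualGen ρ Θ α (jE ϖ ^ j) h x₀ := dualGen_mul_left hz' (jE ϖ ^ j) h x₀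
    refine (hNX (z' • Λ')).2 ⟨z' * x₀, e₀ * ξ'⁻¹, mul_ne_zero hz'0 hx₀, fun x => ?_, ?_, ?_, ?_, ?_, ?_⟩
    · rw [AddSubgroup.mem_smul_pointwise_iff_exists]
      constructor
      · rintro ⟨y, hy, rfl⟩
        obtain ⟨ζ, hζ, rfl⟩ := (hΛx y).1 hy
        exact ⟨ζ, hζ, by rw [smul_eq_mul, mul_assoc]⟩
      · rintro ⟨ζ, hζ, rfl⟩
        exact ⟨x₀ * ζ, (hΛx _).2 ⟨ζ, hζ, rfl⟩, by rw [smul_eq_mul, mul_assoc]⟩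
    · rw [hY]; exact (isOrd_mul_left_iff_of_fixed_unit hρj hj1 (jE ϖ ^ j) _).2 hyO
    · rw [hY, mul_div_assoc, isOrd_mul_left_iff_of_fixed_unit hρj hj1 (jE ϖ ^ j)]; exact hyp
    · rw [hY, Valuation.map_mul, hj1, one_mul, hylev]
    · rw [map_mul, map_inv₀, he₀, hY, map_mul Θ, hΘjξ,
        show μ / (jE ϖ ^ j * (α - ρ α) * (jE ξ' * Θ (dualGen ρ Θ α (jE ϖ ^ j) h x₀))) =
          μ / (jE ϖ ^ j * (α - ρ α) * Θ (dualGen ρ Θ α (jE ϖ ^ j) h x₀)) * (jE ξ')⁻¹ by rw [div_mul_eq_div_mul_one_div]; field_simp,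
        map_mul ρ, map_inv₀ ρ, hρj, add_mul]
    · rw [Valuation.map_mul, map_inv₀, hξ'1, inv_one, mul_one, he₀v]
  refine ⟨fun hP => ?_, key z ξ₀ hz hσξ hξ1 Λ⟩
  -- the inverse flip
  have hj1 : Valued.v (jE ξ₀) = 1 := by rw [hjiso, hξ1]
  have hj0 : jE ξ₀ ≠ 0 := fun h0 => by rw [h0, map_zero] at hj1; exact zero_ne_one hj1
  have hz0 : z ≠ 0 := fun h0 => hj0 (by rw [← hz, h0, zero_mul])
  have hzi : z⁻¹ * Θ z⁻¹ = jE ξ₀⁻¹ := by rw [map_inv₀, ← mul_inv, hz, map_inv₀]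
  have h' := key z⁻¹ ξ₀⁻¹ hzi (by rw [map_inv₀, hσξ]) (by rw [map_inv₀, hξ1, inv_one]) (z • Λ) hP
  rwa [smul_smul, inv_mul_cancel₀ hz0, one_smul] at h'

end Digit

/-! ## §2 HEAD — the product socket of a cone cell on a flip-invariant side digit -/

section Socket

variable {E : Type} {M : Type*} [Field E] [Valued E ℤᵐ⁰] [Field M] [Valued M ℤᵐ⁰] {ρ Θ : M →+* M} {α : M}

/-- **HEAD — «THE PRODUCT SOCKET ON A SIDE DIGIT».**  Frame of ★ p864302 `cellDiff_eq_zero_of_flip_of_prodBalance` VERBATIM (★ `…ConeCellFaceTubeAbove` §3: `σ hσ hvσ ϖ hϖ d t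
hD h2v H₂ hH₂σ hW hhW hhWσ jE hρρ hvρ hα hα1 hint hΘΘ hΘρ hvΘ hΘj hjv hjfix hjpow hϖmax φ hφs hφi hφo γ₂ lam h hφγ hlam hΘh hh hform`, the flip unit `z hz1 ξ hzξ hσξ hξN`,
`u b hb hdb j hlamj f hf`, `hfin`) + TWO cell predicates: the side digit `NX` and the product character `Pc`, each with its FLIP LETTER on the cell (`NX (z • Λ) ↔ NX Λ`,
`Pc (z • Λ) ↔ Pc Λ`), the BALANCE ON THE DIGIT `#{cell ∣ NX ∧ Pc} = #{cell ∣ NX ∧ ¬Pc}`, and the two READS on populated members `f b j Λ ≠ 0 → (P₁ Λ ↔ NX Λ ∧ Pc Λ)`,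
`f b j Λ ≠ 0 → (Q₁ Λ ↔ NX Λ ∧ ¬ Pc Λ)`.  THEN `((Σᶠ_{Λ ∈ cell ∩ {P₁}} f b j Λ : ℕ) : ℤ) − ((Σᶠ_{Λ ∈ cell ∩ {Q₁}} f b j Λ : ℕ) : ℤ) = 0`.  (★ HEAD-hi reduces the weighted face
to the populated parts; the exact ω-flip `Λ ↦ z • Λ` preserves `{cell ∣ NX}` (★ `smul_mem_levelSetDep_iff_of_flip` + `hNX`), reverses populatedness (★
`weight_smul_ne_zero_iff_weight_eq_zero_of_le`) and preserves `Π`; ★ p864302 §1 on `S := {Λ ∈ cell ∣ NX Λ}`.)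
[cite: Rogawski1990, §4.9 Prop. 4.9.1 (b) p. 55] [cite: Kottwitz1986BaseChangeUnits, §1 pp. 240–241] [cite: LabesseLanglands1979, §2 p. 8] [cite: Serre1979, Ch. V §3 Prop. 5, Cor. 2–3 pp. 84–86] -/
theorem cellDiff_eq_zero_of_flip_of_prodBalance_on [CompleteSpace E] [IsDiscreteValuationRing 𝒪[E]] [Finite 𝓀[E]]
    (σ : E →+* E) (hσ : ∀ a, σ (σ a) = a) (hvσ : ∀ a, Valued.v (σ a) = Valued.v a)
    {ϖ : E} (hϖ : Valued.v ϖ = WithZero.exp (-1 : ℤ)) {d t : ℕ} (hD : IsRamifiedQuadraticDatum σ ϖ d t) (h2v : Valued.v (2 : E) < 1)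
    {H₂ : Matrix (Fin 2) (Fin 2) E} (hH₂σ : (H₂.map σ)ᵀ = H₂) {hW : E} (hhW : Valued.v hW = 1) (hhWσ : σ hW = hW) (jE : E →+* M)
    (hρρ : ∀ x, ρ (ρ x) = x) (hvρ : ∀ x, Valued.v (ρ x) = Valued.v x) (hα : ρ α ≠ α) (hα1 : Valued.v α ≤ 1)
    (hint : ∀ z : M, Valued.v z ≤ 1 → Valued.v ((z - ρ z) / (α - ρ α)) ≤ 1)
    (hΘΘ : ∀ x, Θ (Θ x) = x) (hΘρ : ∀ x, Θ (ρ x) = ρ (Θ x)) (hvΘ : ∀ x, Valued.v (Θ x) = Valued.v x) (hΘj : ∀ x, Θ (jE x) = jE (σ x))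
    (hjv : ∀ c, Valued.v (jE c) ≤ 1 ↔ Valued.v c ≤ 1) (hjfix : ∀ z, ρ z = z ↔ ∃ c, jE c = z)
    (hjpow : ∀ (t : E) (n : ℤ), Valued.v (jE t) = Valued.v (jE ϖ) ^ n ↔ Valued.v t = Valued.v ϖ ^ n)
    (hϖmax : ∀ t : M, ρ t = t → Valued.v t < 1 → Valued.v t ≤ Valued.v (jE ϖ))
    (φ : (Fin 2 → E) →+ M) (hφs : ∀ (c : E) (x : Fin 2 → E), φ (c • x) = jE c * φ x) (hφi : Function.Injective φ) (hφo : Function.Surjective φ)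
    {γ₂ : GL (Fin 2) E} {lam h : M} (hφγ : ∀ x, φ ((γ₂ : Matrix (Fin 2) (Fin 2) E).mulVec x) = lam * φ x) (hlam : Valued.v lam = 1)
    (hΘh : Θ h = h) (hh : h ≠ 0) (hform : ∀ x y, jE (pairing σ H₂ x y) = h * Θ (φ x) * φ y + ρ (h * Θ (φ x) * φ y))
    (z : M) (hz1 : Valued.v z = 1) (ξ : E) (hzξ : z * Θ z = jE ξ) (hσξ : σ ξ = ξ) (hξN : ¬ ∃ e : E, e * σ e = ξ)
    (u : E) {b : ℕ} (hb : 1 ≤ b) (hdb : d ≤ b) {j : ℕ} (hlamj : IsOrd ρ α (jE ϖ ^ j) lam)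
    (f : ℕ → ℕ → AddSubgroup M → ℕ)
    (hf : ∀ (b j : ℕ) (Λ : AddSubgroup M) (x₀ : M) (r : E), 1 ≤ b → x₀ ≠ 0 →
      (∀ x, x ∈ Λ ↔ ∃ z, IsOrd ρ α (jE ϖ ^ j) z ∧ x = x₀ * z) →
      IsOrd ρ α (jE ϖ ^ j) (dualGen ρ Θ α (jE ϖ ^ j) h x₀) → ¬ IsOrd ρ α (jE ϖ ^ j) (dualGen ρ Θ α (jE ϖ ^ j) h x₀ / jE ϖ) →
      Valued.v (dualGen ρ Θ α (jE ϖ ^ j) h x₀) = Valued.v (jE ϖ) ^ b →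
      (∀ b', (∀ x ∈ Λ, Valued.v (h * Θ x * b' + ρ (h * Θ x * b')) ≤ 1) → (lam - jE u) * b' ∈ Λ) →
      IsOrd ρ α (jE ϖ ^ j) lam → jE r = glueUnit ρ Θ α (jE ϖ ^ j) h (jE ϖ) (jE hW) x₀ b →
      f b j Λ = Nat.card {x : 𝒪[E] ⧸ 𝓂[E] ^ (2 * b) // ∃ u' : 𝒪[E], Ideal.Quotient.mk (𝓂[E] ^ (2 * b)) u' = x ∧
        Valued.v ((u' : E) * σ u' - r) ≤ Valued.v (ϖ ^ (2 * b))})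
    (hfin : (levelSetDep ρ Θ α (jE ϖ) h j b (lam - jE u)).Finite)
    (NX Pc : AddSubgroup M → Prop)
    (hNX : ∀ Λ ∈ levelSetDep ρ Θ α (jE ϖ) h j b (lam - jE u), NX (z • Λ) ↔ NX Λ)
    (hPc : ∀ Λ ∈ levelSetDep ρ Θ α (jE ϖ) h j b (lam - jE u), Pc (z • Λ) ↔ Pc Λ)
    (hbal : {Λ ∈ levelSetDep ρ Θ α (jE ϖ) h j b (lam - jE u) | NX Λ ∧ Pc Λ}.ncard =
      {Λ ∈ levelSetDep ρ Θ α (jE ϖ) h j b (lam - jE u) | NX Λ ∧ ¬ Pc Λ}.ncard)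
    (P₁ Q₁ : AddSubgroup M → Prop)
    (hP₁ : ∀ Λ ∈ levelSetDep ρ Θ α (jE ϖ) h j b (lam - jE u), f b j Λ ≠ 0 → (P₁ Λ ↔ NX Λ ∧ Pc Λ))
    (hQ₁ : ∀ Λ ∈ levelSetDep ρ Θ α (jE ϖ) h j b (lam - jE u), f b j Λ ≠ 0 → (Q₁ Λ ↔ NX Λ ∧ ¬ Pc Λ)) :
    ((∑ᶠ Λ ∈ levelSetDep ρ Θ α (jE ϖ) h j b (lam - jE u) ∩ {Λ | P₁ Λ}, f b j Λ : ℕ) : ℤ) -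
      ((∑ᶠ Λ ∈ levelSetDep ρ Θ α (jE ϖ) h j b (lam - jE u) ∩ {Λ | Q₁ Λ}, f b j Λ : ℕ) : ℤ) = 0 := by
  rw [sub_eq_zero, Nat.cast_inj]
  refine (finsum_levelSetDep_inter_weight_eq_iff_of_le σ hσ hvσ hϖ hD h2v hH₂σ hhW hhWσ jE hρρ hvρ hα hα1 hint hΘΘ hΘρ hvΘ hΘj hjv hjfix hjpow hϖmax
    φ hφs hφi hφo hφγ hlam hΘh hh hform u hb hdb hlamj f hf P₁ Q₁).2 ?_
  -- the `NX`-part of the cell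
  set S : Set (AddSubgroup M) := {Λ ∈ levelSetDep ρ Θ α (jE ϖ) h j b (lam - jE u) | NX Λ} with hSdef
  have hSfin : S.Finite := hfin.subset fun Λ hΛ => hΛ.1
  -- the two populated labelled parts are the two populated `Π`-halves of `S`
  have hP' : {Λ ∈ levelSetDep ρ Θ α (jE ϖ) h j b (lam - jE u) | P₁ Λ ∧ f b j Λ ≠ 0} = {Λ ∈ S | f b j Λ ≠ 0 ∧ Pc Λ} := by
    ext Λ
    simp only [hSdef, Set.mem_setOf_eq]
    constructor
    · rintro ⟨hΛ, hP, hw⟩; exact ⟨⟨hΛ, ((hP₁ Λ hΛ hw).1 hP).1⟩, hw, ((hP₁ Λ hΛ hw).1 hP).2⟩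
    · rintro ⟨⟨hΛ, hN⟩, hw, hπ⟩; exact ⟨hΛ, (hP₁ Λ hΛ hw).2 ⟨hN, hπ⟩, hw⟩
  have hQ' : {Λ ∈ levelSetDep ρ Θ α (jE ϖ) h j b (lam - jE u) | Q₁ Λ ∧ f b j Λ ≠ 0} = {Λ ∈ S | f b j Λ ≠ 0 ∧ ¬ Pc Λ} := by
    ext Λ
    simp only [hSdef, Set.mem_setOf_eq]
    constructor
    · rintro ⟨hΛ, hQ, hw⟩; exact ⟨⟨hΛ, ((hQ₁ Λ hΛ hw).1 hQ).1⟩, hw, ((hQ₁ Λ hΛ hw).1 hQ).2⟩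
    · rintro ⟨⟨hΛ, hN⟩, hw, hπ⟩; exact ⟨hΛ, (hQ₁ Λ hΛ hw).2 ⟨hN, hπ⟩, hw⟩
  have hbal' : {Λ ∈ S | Pc Λ}.ncard = {Λ ∈ S | ¬ Pc Λ}.ncard := by
    have e1 : {Λ ∈ S | Pc Λ} = {Λ ∈ levelSetDep ρ Θ α (jE ϖ) h j b (lam - jE u) | NX Λ ∧ Pc Λ} := by
      ext Λ; simp only [hSdef, Set.mem_setOf_eq, and_assoc]
    have e2 : {Λ ∈ S | ¬ Pc Λ} = {Λ ∈ levelSetDep ρ Θ α (jE ϖ) h j b (lam - jE u) | NX Λ ∧ ¬ Pc Λ} := by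
      ext Λ; simp only [hSdef, Set.mem_setOf_eq, and_assoc]
    rw [e1, e2]; exact hbal
  rw [hP', hQ']
  -- the flip as a permutation of `AddSubgroup M`
  set ξ' : M := jE ξ with hξ'def
  have hρξ' : ρ ξ' = ξ' := (hjfix ξ').2 ⟨ξ, rfl⟩
  have hξ'1 : Valued.v ξ' = 1 := by rw [← hzξ, map_mul, hvΘ, hz1, one_mul]
  have hξ'0 : ξ' ≠ 0 := fun h0 => by rw [h0, map_zero] at hξ'1; exact zero_ne_one hξ'1
  have hz0 : z ≠ 0 := ne_zero_of_mul_map_eq hzξ hξ'0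
  let τ : AddSubgroup M ≃ AddSubgroup M :=
    ⟨fun Λ => z • Λ, fun Λ => z⁻¹ • Λ, fun Λ => by simp only [smul_smul, inv_mul_cancel₀ hz0, one_smul],
      fun Λ => by simp only [smul_smul, mul_inv_cancel₀ hz0, one_smul]⟩
  have hτc : ∀ Λ, τ Λ ∈ levelSetDep ρ Θ α (jE ϖ) h j b (lam - jE u) ↔ Λ ∈ levelSetDep ρ Θ α (jE ϖ) h j b (lam - jE u) := fun Λ =>
    smul_mem_levelSetDep_iff_of_flip hzξ hρξ' hξ'1 (jE ϖ) h j b (lam - jE u) Λ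
  have hτ : ∀ Λ, τ Λ ∈ S ↔ Λ ∈ S := fun Λ => by
    simp only [hSdef, Set.mem_setOf_eq]
    constructor
    · rintro ⟨hΛ, hN⟩
      have hΛ' := (hτc Λ).1 hΛ
      exact ⟨hΛ', (hNX Λ hΛ').1 hN⟩
    · rintro ⟨hΛ, hN⟩
      exact ⟨(hτc Λ).2 hΛ, (hNX Λ hΛ).2 hN⟩
  have hrev : ∀ Λ ∈ S, f b j (τ Λ) ≠ 0 ↔ f b j Λ = 0 := fun Λ hΛ =>
    weight_smul_ne_zero_iff_weight_eq_zero_of_le σ hσ hvσ hϖ hD h2v hH₂σ hhW hhWσ jE hρρ hvρ hα hα1 hint hΘΘ hΘρ hvΘ hΘj hjv hjfix hjpow hϖmax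
      φ hφs hφi hφo hφγ hlam hΘh hh hform z hz1 ξ hzξ hσξ hξN u hb hdb hlamj f hf hΛ.1
  exact ncard_sep_and_eq_of_supportReversing_of_invariant _ hSfin τ hτ (f b j) Pc hrev (fun Λ hΛ => hPc Λ hΛ.1) hbal'

end Socket

end Summit.HodgeConjecture.HodgeConjecture.Cruxes.H413.F0P3cDyRamMixBandProductSocket

end
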